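import Summits.QuantumFields.BalabanUV.Beta.KernelWardResidual
import Summits.QuantumFields.BalabanUV.Beta.KernelWardLevels
import Summits.QuantumFields.BalabanUV.Beta.SpineRecursiveW

/-!
# `BalabanUV.Beta.WardLocusResidualClass` — binder row D1, (L4) W-side of hW, «HW-CLASS-Q» part 1: THE QUANTITATIVE CLASS OF THE WARD RESIDUAL —
# the residual `½(𝒩 + 𝒩″)` of the second-order Ward kernel law (`KernelWardSymAssembly` / `WardLocusRecursiveStep`) is, for every coarse site `y`, a
# VERTEX FAMILY in its bond variable `(ν, y′)` with constants UNIFORM in `y`; and a family with that class, sandwiched by the step propagator and `mm`-read on the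
# next lattice, is a LOCAL STENCIL family with uniform constants — the class that part A's `hS₂` remainder and the next level's `hRb` need
# (β sub-cell, D1 formalisation swarm, unit `b2b-balaban-beta-d1-formalise-leaf-06`, gen 3; CLAIM «D1-hW-L4-WARD-ALL» journal 2026-08-20)

NOT IN PRINT; OUR BOOKKEEPING.  HONEST FRAMING (cell charter, verbatim): «discharging `BetaPertH` makes Bałaban's UV stability UNCONDITIONAL — a real
constructive-QFT result; it is NOT the continuum limit and NOT the Clay problem.»  HONEST DEPENDENCY (verbatim): «continuum YM on T⁴ ⇐ BetaPertH ∧ nine spine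
estimates (0/9 proved); BetaPertH ⇐ (D1) ∧ (D4) ∧ CAP+tail; G-an2-4 gates asym, D1 and NE2/3/4.»  [folklore] decay bookkeeping over tree lemmas BY NAME
(`SecondOrderResponse.vertexFamily_dM`, an1-g27's `KernelWardResidual.biLoc_gaugeSup`, `ExpKernelCalculus.biLoc_comp_decays`, `BalabanStepJetsSucc.biLoc_comp_right`,
`biLoc_mmRead`); nothing of Bałaban's papers, no `[cite:]`, no `def`, no `def … : Prop`; instantiates NO binder of the β-function wall.  NOT hW, NOT D1,
NOT `BetaPertH`, NOT continuum, NOT Clay.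

WHY.  In the all-levels hW induction (`WardLocusRecursiveAll`), the level-(j+1) first-slot remainder is
`R Y κ′ u′ = −c • Σ_{v ∈ box} mmRead Lc (G_j ∘ 𝒩_j (Lc•Y + v) κ′ u′ ∘ G_j) + RB Y κ′ u′`; `KernelWardSymAssembly` needs it BOUNDED uniformly, and the level-(j+1)
residual's localisation (an1's `loc_residual`) needs `R Y` to be a `LocStencil` family.  Both follow if the level-`j` residual `𝒩_j y` is, for EVERY `y`, a vertex
family in `(ν, y′)` with `y`-uniform constants (§2–§3), by §4.  an1's `loc_residual` proves exactly this but exports only `Loc`; here the constants are kept.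
* §1 `decays_comp_diagK_of_bdd`, `decays_diagK_comp_of_bdd`, `decays_conjV_diagK_of_bdd`, `abs_blockGen_le` — a decaying kernel composed with a BOUNDED diagonal
  kernel decays at the same rate (entrywise: `comp_diagK_right/left`); the block rotation generator's symbol is bounded by `|ξ|·|box|`.
* §2 `exists_vertexFamily_residual` — an1's direct residual `𝒩 y ν y′ = dM K N (R y) (RM y) ν y′ − cH • 𝒟_{S,M}[(K∘dM K N S M ν y′) ĝ_y]` is a vertex family in
  `(ν, y′)`, constants uniform in `y` (generic decaying `K`, localised `S`, `M`, `R y`, `RM y` at one rate).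
* §3 `exists_vertexFamily_residual''` — leaf-10's swapped residual `𝒩″ y ν y′ = dM K N (R″ y) (RM y) ν y′ + dM (conjV K (diagK (g y))) N S M ν y′` likewise, for
  any `y`-uniformly bounded symbol family `g`; `exists_vertexFamily_halfSum` — hence `½ • (𝒩 + 𝒩″)`.
* §4 `exists_locStencil_transport` — for a family `V w` of vertex families (uniform constants) and a decaying `G`, `Y κ′ u′ ↦ Σ_{v ∈ box} mmRead N (G ∘ V (N•Y + v) κ′ u′ ∘ G)`
  is, for every `Y`, a `LocStencil` family with `Y`-uniform constants; `abs_transport_le` — hence uniformly bounded.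
Provenance: D1 formalisation swarm, leaf prover 06 (gen 3), 2026-08-20; no existing file touched.
-/

noncomputable section

open Finset
open scoped BigOperators
open Literature.MathematicalPhysics.QuantumFieldTheory
open Literature.MathematicalPhysics.QuantumFieldTheory.Balaban1983to89
open Literature.MathematicalPhysics.QuantumFieldTheory.Balaban1983to89.Beta
open B12Sec2to5 (l1 l1_nonneg)
open ExpKernelCalculus (MKer Decays BiLoc VertexFamily comp Zl Zl_nonneg biLoc_comp_decays)
open KernelWard (divV divW biLoc_add biLoc_sub biLoc_finset_sum bdd_of_biLoc)
open AffineAveraging (Site box toSite)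
open OneStepResolventKernel (Fib wsum LocStencil biLoc_mono decays_mono)
open OneStepKernelFamily (KInvStep colH vertexOfK)
open InterLevelTransport (cwsum)
open BalabanStepJetsSucc (mmRead biLoc_comp_right biLoc_mmRead)
open SecondOrderResponse (colM vertexOfM dM vertexFamily_dM)
open StepJetData (biLoc_smul)
open HessKerRate (decays_sub)
open Summit.QuantumFields.BalabanUV.Beta.TameKernelCalculus
open Summit.QuantumFields.BalabanUV.Beta.BorderedHessian (diagK comp_diagK_right comp_diagK_left)
open Summit.QuantumFields.BalabanUV.Beta.ChartConjugation (conjV)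
open Summit.QuantumFields.BalabanUV.Beta.AveragingWardRootedStencils (legInd)
open Summit.QuantumFields.BalabanUV.Beta.KernelWardRelative (gaugeWt)
open Summit.QuantumFields.BalabanUV.Beta.KernelWardLevels (abs_sum_legInd_apply_le)
open Summit.QuantumFields.BalabanUV.Beta.KernelWardResidual (biLoc_gaugeSup)

namespace Summit.QuantumFields.BalabanUV.Beta.WardLocusResidualClass

variable {d : ℕ}

/-! ## §1 Decay bookkeeping for bounded diagonal kernels -/

section Diag

/-- [folklore] A decaying kernel composed on the RIGHT with a bounded diagonal kernel decays at the same rate (`comp_diagK_right`). -/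
theorem decays_comp_diagK_of_bdd {K : MKer (d + 1) (Fib d)} {C δ : ℝ} (hK : Decays K C δ) {g : (Fin (d + 1) → ℤ) → Fib d → ℝ} {B : ℝ}
    (hg : ∀ z b, |g z b| ≤ B) : Decays (comp K (diagK g)) (C * B) δ := by
  intro x z a b
  rw [comp_diagK_right, abs_mul]
  have hC : 0 ≤ C * Real.exp (-δ * l1 (x - z)) := (abs_nonneg _).trans (hK x z a b)
  calc |K x z a b| * |g z b| ≤ C * Real.exp (-δ * l1 (x - z)) * B :=
        mul_le_mul (hK x z a b) (hg z b) (abs_nonneg _) hC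
    _ = C * B * Real.exp (-δ * l1 (x - z)) := by ring

/-- [folklore] A decaying kernel composed on the LEFT with a bounded diagonal kernel decays at the same rate (`comp_diagK_left`). -/
theorem decays_diagK_comp_of_bdd {K : MKer (d + 1) (Fib d)} {C δ : ℝ} (hK : Decays K C δ) {g : (Fin (d + 1) → ℤ) → Fib d → ℝ} {B : ℝ}
    (hg : ∀ z b, |g z b| ≤ B) : Decays (comp (diagK g) K) (C * B) δ := by
  intro x z a b
  rw [comp_diagK_left, abs_mul]
  have hC : 0 ≤ C * Real.exp (-δ * l1 (x - z)) := (abs_nonneg _).trans (hK x z a b)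
  calc |g x a| * |K x z a b| ≤ B * (C * Real.exp (-δ * l1 (x - z))) :=
        mul_le_mul (hg x a) (hK x z a b) (abs_nonneg _) ((abs_nonneg _).trans (hg x a))
    _ = C * B * Real.exp (-δ * l1 (x - z)) := by ring

/-- [folklore] **THE FIRST-ORDER CONTACT OF A DECAYING KERNEL WITH A BOUNDED DIAGONAL GENERATOR DECAYS** (`conjV K X = K∘X − X∘K`), constant `2·C·B`. -/
theorem decays_conjV_diagK_of_bdd {K : MKer (d + 1) (Fib d)} {C δ : ℝ} (hK : Decays K C δ) {g : (Fin (d + 1) → ℤ) → Fib d → ℝ} {B : ℝ}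
    (hg : ∀ z b, |g z b| ≤ B) : Decays (conjV K (diagK g)) (C * B + C * B) δ := by
  unfold ChartConjugation.conjV
  exact decays_sub (decays_comp_diagK_of_bdd hK hg) (decays_diagK_comp_of_bdd hK hg)

/-- [folklore] **THE BLOCK ROTATION GENERATOR's SYMBOL IS BOUNDED, UNIFORMLY IN THE COARSE SITE**: `|(ξ • Σ_{v ∈ box} legInd ρ (N•y + v)) z b| ≤ |ξ|·|box|`. -/
theorem abs_blockGen_le (N : ℕ) (ρ : Fin (d + 1) → ℤ) (ξ : ℝ) (y z : Fin (d + 1) → ℤ) (b : Fib d) :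
    |(ξ • ∑ v ∈ box (d + 1) N, legInd ρ ((N : ℤ) • y + toSite v)) z b| ≤ |ξ| * (box (d + 1) N).card := by
  rw [Pi.smul_apply, Pi.smul_apply, smul_eq_mul, abs_mul]
  exact mul_le_mul_of_nonneg_left (abs_sum_legInd_apply_le _ _ _ _ _) (abs_nonneg _)

end Diag

/-! ## §2 an1's direct residual is a vertex family in its bond variable, uniformly in the coarse site -/

section Residual

variable {N : ℕ} [NeZero N]

/-- [folklore] **THE DIRECT RESIDUAL `𝒩` IS A VERTEX FAMILY IN `(ν, y′)`, UNIFORMLY IN `y`** — an1-g27's `KernelWardResidual.loc_residual` with the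
constants kept: for a decaying `K` (rate `m`), localised tables `S`, `M` and remainder tables `R y`, `RM y` (all at rate `m`, constants uniform in `y`), and any
contact constant `cH`, there is ONE constant `C′` with `VertexFamily (fun ν y′ ↦ 𝒩 y ν y′) N C′ (m/8)` for EVERY `y`
(`vertexFamily_dM` ×2, `biLoc_comp_decays`, `biLoc_gaugeSup`). -/
theorem exists_vertexFamily_residual {K : MKer (d + 1) (Fib d)} {C m : ℝ} (hK : Decays K C m) (hC : 0 ≤ C) (hm : 0 < m)
    {S : Fin (d + 1) → Site (d + 1) → MKer (d + 1) (Fib d)} {Cs : ℝ} (hS : LocStencil S Cs m)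
    {M : Fin (d + 1) → Site (d + 1) → MKer (d + 1) (Fib d)} {CM : ℝ} (hM : VertexFamily M N CM m)
    {R : Site (d + 1) → Fin (d + 1) → Site (d + 1) → MKer (d + 1) (Fib d)} {CR : ℝ} (hR : ∀ y, LocStencil (R y) CR m)
    {RM : Site (d + 1) → Fin (d + 1) → Site (d + 1) → MKer (d + 1) (Fib d)} {CRM : ℝ} (hRM : ∀ y, VertexFamily (RM y) N CRM m) (cH : ℝ) :
    ∃ C' : ℝ, ∀ y : Site (d + 1), VertexFamily (fun ν y' =>
      dM K N (R y) (RM y) ν y'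
        - cH • (∑ κ, wsum (fun u => ∑' x₂, ∑ κ₂,
              comp K (dM K N S M ν y') u x₂ (Sum.inl κ) (Sum.inl κ₂) * gaugeWt N y κ₂ x₂) (S κ)
            + ∑ ρ, cwsum N (fun w => ∑' x₂, ∑ κ₂,
              comp K (dM K N S M ν y') ((N : ℤ) • w) x₂ (Sum.inr ρ) (Sum.inl κ₂) * gaugeWt N y κ₂ x₂) (M ρ))) N C' (m / 8) := by
  have hm4 : 0 < m / 4 := by positivity
  have hK2 : Decays K C (m / 2) := decays_mono hK hC le_rfl (by linarith)
  have hS' : LocStencil S Cs (m / 4) := fun κ u => biLoc_mono (hS κ u) ((hS κ u).nonneg (Sum.inl 0)) (by linarith)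
  have hM' : VertexFamily M N CM (m / 4) := fun ρ w => biLoc_mono (hM ρ w) ((hM ρ w).nonneg (Sum.inl 0)) (by linarith)
  have h8 : m / 4 / 2 = m / 8 := by ring
  -- per bond: the remainder vertex (rate `m/2` ↘ `m/8`) minus `cH •` the gauge superposition of the response kernel (rate `m/8`); constants free of `y`
  have key : ∀ (y : Site (d + 1)) (ν : Fin (d + 1)) (y' : Site (d + 1)), BiLoc
      (dM K N (R y) (RM y) ν y'
        - cH • (∑ κ, wsum (fun u => ∑' x₂, ∑ κ₂,
              comp K (dM K N S M ν y') u x₂ (Sum.inl κ) (Sum.inl κ₂) * gaugeWt N y κ₂ x₂) (S κ)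
            + ∑ ρ, cwsum N (fun w => ∑' x₂, ∑ κ₂,
              comp K (dM K N S M ν y') ((N : ℤ) • w) x₂ (Sum.inr ρ) (Sum.inl κ₂) * gaugeWt N y κ₂ x₂) (M ρ)))
      ((N : ℤ) • y') ((N : ℤ) • y') _ (m / 4 / 2) := fun y ν y' =>
    biLoc_sub
      (biLoc_mono (vertexFamily_dM hK hC (hR y) (hRM y) hm le_rfl ν y') ((vertexFamily_dM hK hC (hR y) (hRM y) hm le_rfl ν y').nonneg (Sum.inl 0))
        (show m / 4 / 2 ≤ m / 2 by linarith))
      (biLoc_smul (biLoc_gaugeSup (biLoc_comp_decays hK2 (vertexFamily_dM hK hC hS hM hm le_rfl ν y') hm4.le (by linarith)) hm4 hS' hM' y) cH)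
  rw [h8] at key
  exact ⟨_, key⟩

end Residual

/-! ## §3 The swapped residual and the half-sum -/

section Swapped

variable {N : ℕ} [NeZero N]

/-- [folklore] **THE SWAPPED RESIDUAL `𝒩″` IS A VERTEX FAMILY IN `(ν, y′)`, UNIFORMLY IN `y`**: `dM K N (R″ y) (RM y) ν y′ + dM (conjV K (diagK (g y))) N S M ν y′`
for a `y`-uniformly bounded symbol family `g` (`vertexFamily_dM` ×2, §1 for the rotated kernel's decay). -/
theorem exists_vertexFamily_residual'' {K : MKer (d + 1) (Fib d)} {C m : ℝ} (hK : Decays K C m) (hC : 0 ≤ C) (hm : 0 < m)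
    {S : Fin (d + 1) → Site (d + 1) → MKer (d + 1) (Fib d)} {Cs : ℝ} (hS : LocStencil S Cs m)
    {M : Fin (d + 1) → Site (d + 1) → MKer (d + 1) (Fib d)} {CM : ℝ} (hM : VertexFamily M N CM m)
    {R'' : Site (d + 1) → Fin (d + 1) → Site (d + 1) → MKer (d + 1) (Fib d)} {CR'' : ℝ} (hR'' : ∀ y, LocStencil (R'' y) CR'' m)
    {RM : Site (d + 1) → Fin (d + 1) → Site (d + 1) → MKer (d + 1) (Fib d)} {CRM : ℝ} (hRM : ∀ y, VertexFamily (RM y) N CRM m)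
    {g : Site (d + 1) → Site (d + 1) → Fib d → ℝ} {B : ℝ} (hg : ∀ y z b, |g y z b| ≤ B) :
    ∃ C' : ℝ, ∀ y : Site (d + 1), VertexFamily (fun ν y' =>
      dM K N (R'' y) (RM y) ν y' + dM (conjV K (diagK (g y))) N S M ν y') N C' (m / 2) := by
  have hB : 0 ≤ B := (abs_nonneg _).trans (hg 0 0 (Sum.inl 0))
  have hCB : 0 ≤ C * B + C * B := by positivity
  have key : ∀ (y : Site (d + 1)) (ν : Fin (d + 1)) (y' : Site (d + 1)), BiLoc
      (dM K N (R'' y) (RM y) ν y' + dM (conjV K (diagK (g y))) N S M ν y') ((N : ℤ) • y') ((N : ℤ) • y') _ (m / 2) := fun y ν y' =>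
    biLoc_add (vertexFamily_dM hK hC (hR'' y) (hRM y) hm le_rfl ν y')
      (vertexFamily_dM (decays_conjV_diagK_of_bdd hK (hg y)) hCB hS hM hm le_rfl ν y')
  exact ⟨_, key⟩

omit [NeZero N] in
/-- [folklore] **THE FULL RESIDUAL `½ • (𝒩 + 𝒩″)` OF THE SYMMETRISED KERNEL LAW IS A VERTEX FAMILY IN `(ν, y′)`, UNIFORMLY IN `y`** (§2 + §3, `biLoc_smul`). -/
theorem exists_vertexFamily_halfSum {𝒩 𝒩'' : Site (d + 1) → Fin (d + 1) → Site (d + 1) → MKer (d + 1) (Fib d)} {C₁ C₂ δ₁ δ₂ : ℝ}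
    (hδ : δ₁ ≤ δ₂) (h₁ : ∀ y, VertexFamily (𝒩 y) N C₁ δ₁) (h₂ : ∀ y, VertexFamily (𝒩'' y) N C₂ δ₂) :
    ∃ C' : ℝ, ∀ y : Site (d + 1), VertexFamily (fun ν y' => (1 / 2 : ℝ) • (𝒩 y ν y' + 𝒩'' y ν y')) N C' δ₁ := by
  refine ⟨|(1 / 2 : ℝ)| * (C₁ + |C₂|), fun y ν y' => ?_⟩
  have h₂' : BiLoc (𝒩'' y ν y') ((N : ℤ) • y') ((N : ℤ) • y') (|C₂|) δ₁ := biLoc_of_le (h₂ y ν y') hδ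
  exact biLoc_smul (biLoc_add (h₁ y ν y') h₂') (1 / 2 : ℝ)

end Swapped

/-! ## §4 Transport to the next level: the sandwiched, `mm`-read residual is a local stencil family, uniformly; hence bounded -/

section Transport

variable {N : ℕ}

/-- [folklore] **THE TRANSPORTED RESIDUAL IS A LOCAL STENCIL FAMILY, UNIFORMLY IN THE COARSE SITE.**  If every `V w` (`w` a fine site of the current
level) is a vertex family in `(κ′, u′)` with constants uniform in `w` (`BiLoc (V w κ′ u′) (N•u′) (N•u′) Cv δ`) and `G` decays at rate `δ`, then for every coarse
site `Y` of the next level `κ′ u′ ↦ Σ_{v ∈ box} mmRead N (G ∘ V (N•Y + v) κ′ u′ ∘ G)` is a `LocStencil` family at rate `δ/4`, constant uniform in `Y`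
(`biLoc_comp_decays`, `biLoc_comp_right`, `biLoc_mmRead`, `biLoc_finset_sum`) — the class part A's `hS₂` remainder of the `e4OfKW` sector has at the next level. -/
theorem exists_locStencil_transport (hN : 1 ≤ N) {G : MKer (d + 1) (Fib d)} {CG δ : ℝ} (hG : Decays G CG δ) (hCG : 0 ≤ CG) (hδ : 0 < δ)
    {V : Site (d + 1) → Fin (d + 1) → Site (d + 1) → MKer (d + 1) (Fib d)} {Cv : ℝ} (hV : ∀ w, VertexFamily (V w) N Cv δ) :
    ∃ C' : ℝ, ∀ Y : Site (d + 1), LocStencil (fun κ' u' =>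
      ∑ v ∈ box (d + 1) N, mmRead N (comp (comp G (V ((N : ℤ) • Y + toSite v) κ' u')) G)) C' (δ / 4) := by
  have hG2 : Decays G CG (δ / 2) := decays_mono hG hCG le_rfl (by linarith)
  have hδ2 : (0 : ℝ) ≤ δ / 2 := by positivity
  have hδ4 : (0 : ℝ) ≤ δ / 4 := by positivity
  have hlt1 : δ / 2 < δ := by linarith
  have hlt2 : δ / 4 < δ / 2 := by linarith
  have key : ∀ (Y : Site (d + 1)) (κ' : Fin (d + 1)) (u' : Site (d + 1)), BiLoc
      (∑ v ∈ box (d + 1) N, mmRead N (comp (comp G (V ((N : ℤ) • Y + toSite v) κ' u')) G)) u' u' _ (δ / 4) := fun Y κ' u' =>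
    biLoc_finset_sum (box (d + 1) N) fun v _ =>
      biLoc_mmRead hN (biLoc_comp_right (biLoc_comp_decays hG (hV ((N : ℤ) • Y + toSite v) κ' u') hδ2 hlt1) hG2 hδ4 hlt2) hδ4
  simp only [Finset.sum_const] at key
  exact ⟨_, key⟩

/-- [folklore] **… HENCE UNIFORMLY BOUNDED** (`bdd_of_biLoc`) — the `hRb`-type input of `KernelWardSymAssembly` at the next level. -/
theorem abs_transport_le (hN : 1 ≤ N) {G : MKer (d + 1) (Fib d)} {CG δ : ℝ} (hG : Decays G CG δ) (hCG : 0 ≤ CG) (hδ : 0 < δ)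
    {V : Site (d + 1) → Fin (d + 1) → Site (d + 1) → MKer (d + 1) (Fib d)} {Cv : ℝ} (hV : ∀ w, VertexFamily (V w) N Cv δ) :
    ∃ B : ℝ, ∀ (Y : Site (d + 1)) (κ' : Fin (d + 1)) (u' x z : Site (d + 1)) (a b : Fib d),
      |(∑ v ∈ box (d + 1) N, mmRead N (comp (comp G (V ((N : ℤ) • Y + toSite v) κ' u')) G)) x z a b| ≤ B := by
  obtain ⟨C', hC'⟩ := exists_locStencil_transport hN hG hCG hδ hV
  exact ⟨C', fun Y κ' u' x z a b => bdd_of_biLoc (hC' Y κ' u') (by positivity : (0 : ℝ) ≤ δ / 4) x z a b⟩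

end Transport

end Summit.QuantumFields.BalabanUV.Beta.WardLocusResidualClass

end
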